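import Summits.QuantumFields.BalabanUV.Beta.GAN24.FibreSymbolShift

/-!
# `BalabanUV.Beta.GAN24.FibreSymbolShiftCosh` — binder row G-an2-4 / (CONV-C), propagator slot, road P1-fibre, typer row **P1-Y10c** (DAG node N15c), PART 2:
# the shifted Bloch symbol conjugated by an INTRA-BLOCK DIAGONAL WEIGHT `D_f = diagonal (exp ∘ f)` (typer amendment 2026-08-20T00:03:51Z),
# THE COSH IDENTITY for the real part of its form, the defect bound `(cosh Θ − 1)·ρ·‖x‖²`, and the similarity `F⁻¹ = D_f⁻¹ (D_f F D_f⁻¹)⁻¹ D_f`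
# (input of gan24-p1's L10 `FibreStrip`, «form-version Combes–Thomas + Brezzi, NOT termwise»; PART 1 = `GAN24/FibreSymbolShift`)

NOT IN PRINT; OUR PROOF ATTEMPT.  HONEST FRAMING (cell contract, verbatim): «discharging `BetaPertH` makes Bałaban's UV stability
UNCONDITIONAL — a real constructive-QFT result; it is NOT the continuum limit and NOT the Clay problem.»  HONEST DEPENDENCY (verbatim):
«continuum YM on T⁴ ⇐ BetaPertH ∧ nine spine estimates (0/9 proved); BetaPertH ⇐ (D1) ∧ (D4) ∧ CAP+tail; G-an2-4 gates asym, D1 and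
NE2/3/4.»  [folklore] finite algebra over `FibreInverseDecay.trigPolySymbol S L`, general finite index type `n`, general `(S, L)`, general intra-block
weight `f : n → ℝ`.  Cites nothing, mints no fact (every hypothesis is a displayed binder), instantiates NO wall binder, proves NO `j`-uniform estimate.
NOT BetaPertH, NOT continuum, NOT Clay.  (Unit b2b-balaban-gan24-formalise-leaf-01-g5; row P1-Y10c of `HOME/GAN24/Formal/LEAVES.md` v2.4 as AMENDED
00:03:51Z / typer NOTE 00:04:14Z; fibre analogue of `King1986.UniformDecay.form_conj_eq_cosh` and `Beta.DeltaACombesThomas.re_conjugated_form`.)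

WHY THE INTRA-BLOCK WEIGHT (typer NOTE 00:04:14Z, leaf-06 OBJECTION 00:11:17Z, recorded — not adjudicated here): with `f = 0` every block-FACE bond is
stretched by `η` and the form defect is `(cosh(ηR) − 1)·(face mass)`, not `N`-uniform against a constrained coercivity `γ/N²`; with `f i = η a·r_i/N`
(fine position `r_i`) every fine bond is stretched by `≤ η|a|₁/N`.  This file proves the identity and the defect bound for EVERY `f`; the choice of `f`,
the support bound `Θ` and the Schur bound `ρ` of the KKT pieces are the L10 owner's (hypotheses `hΘ`, `hrow`, `hcol` below).

## What is proved (`F := trigPolySymbol S L`, `⟨x, y⟩ := star x ⬝ᵥ y`, `Fw := wConj f (F(q + iηa)) = D_f · F(q+iηa) · D_{−f}`, real `q`, real `η`)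
§5 `dw f = diagonal (e^{f})`, `wConj f M = dw f * M * dw (−f)`: entries `e^{f i − f j} M i j` (`wConj_apply`), `wConj 0 M = M`, `wConj (−f) (wConj f M) = M`,
   `(wConj f M)ᴴ = wConj (−f) Mᴴ`, `(wConj f M)⁻¹ = wConj f M⁻¹` and **(d) the similarity `M⁻¹ = wConj (−f) ((wConj f M)⁻¹)`**; the entries of the weighted
   shifted symbol `Fw i j = Σ_{b∈S} e^{f i − f j − η a·b} cphase b q · L b i j` (`wConj_trigPolySymbol_imShift_apply`).
§6 **(c) THE COSH IDENTITY** under `hS : b ∈ S → −b ∈ S`, `hL : L(−b) = (L b)ᴴ`: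
   `re ⟨x, Fw x⟩ = Σ_{b∈S} Σ_i Σ_j cosh(f i − f j − η a·b) · re(cphase b q · L b i j · conj(x i) · x j)` (`re_form_wConj_imShift_eq_cosh`; pairing
   `(b,i,j) ↔ (−b,j,i)`, the `sinh` part is odd), and its `f = 0` form `re ⟨x, F(q+iηa) x⟩ = Σ_b cosh(η a·b) · re(cphase b q · ⟨x, L b x⟩)` (`re_form_imShift_eq_cosh`).
§7 (c) THE DEFECT: `re ⟨x, Fw x⟩ − re ⟨x, F(q) x⟩ = Σ (cosh(…) − 1)·re(…)`; under the SUPPORT RANGE `hΘ : L b i j ≠ 0 → |f i − f j − η a·b| ≤ Θ` and the SCHUR bounds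
   `hrow/hcol : Σ_j Σ_b ‖L b i j‖ ≤ ρ` (rows and columns): `|defect| ≤ (cosh Θ − 1)·ρ·Σ_i ‖x i‖²`, whence `re ⟨x, Fw x⟩ ≥ re ⟨x, F(q) x⟩ − (cosh Θ − 1)ρ Σ_i ‖x i‖²`.
   The Euclidean (`toEuclideanLin`) currency, the coercivity transfer and the stencil instance are PART 3 `GAN24/FibreSymbolShiftCoercive`.
-/

noncomputable section

open Complex Finset Matrix WithLp
open scoped BigOperators InnerProductSpace ComplexConjugate
open Literature.MathematicalPhysics.QuantumFieldTheory
open Literature.MathematicalPhysics.QuantumFieldTheory.Balaban1983to89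
open Literature.MathematicalPhysics.QuantumFieldTheory.Balaban1983to89.Beta
open B4Strip (ofRealVec Strip)
open FibreInverseDecay (cphase trigPolySymbol trigPolySymbol_apply)
open BlochFibreMatrix (stencil mem_stencil)
open Summit.QuantumFields.BalabanUV.Beta.GAN24.CombesThomasFibreStep (cphase_add_eq_mul cphase_zero_left)
open Summit.QuantumFields.BalabanUV.Beta.GAN24.FibreStepResidues (norm_cphase_ofRealVec)
open Summit.QuantumFields.BalabanUV.Beta.GAN24.FibreSymbolShift

namespace Summit.QuantumFields.BalabanUV.Beta.GAN24.FibreSymbolShiftCosh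

variable {d : ℕ} {n : Type*} [Fintype n] [DecidableEq n]

/-! ## §5 The intra-block diagonal weight `D_f` and the weighted conjugation `wConj f M = D_f M D_{−f}` -/

/-- [folklore] the diagonal weight `D_f = diagonal (e^{f i})`. -/
def dw (f : n → ℝ) : Matrix n n ℂ := Matrix.diagonal fun i => ((Real.exp (f i) : ℝ) : ℂ)

/-- [folklore] the weighted conjugation `D_f · M · D_{−f}` (`D_{−f} = D_f⁻¹`). -/
def wConj (f : n → ℝ) (M : Matrix n n ℂ) : Matrix n n ℂ := dw f * M * dw (-f)

/-- [folklore] `D_f D_g = D_{f+g}`. -/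
theorem dw_mul_dw (f g : n → ℝ) : dw f * dw g = dw (f + g) := by
  unfold dw
  rw [Matrix.diagonal_mul_diagonal]
  congr 1
  funext i
  rw [Pi.add_apply, Real.exp_add, Complex.ofReal_mul]

omit [Fintype n] in
/-- [folklore] `D_0 = 1`. -/
theorem dw_zero : dw (0 : n → ℝ) = 1 := by
  unfold dw
  simp only [Pi.zero_apply, Real.exp_zero, Complex.ofReal_one, Matrix.diagonal_one]

/-- [folklore] `D_f D_{−f} = 1`. -/
theorem dw_mul_dw_neg (f : n → ℝ) : dw f * dw (-f) = 1 := by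
  rw [dw_mul_dw, add_neg_cancel, dw_zero]

/-- [folklore] `D_{−f} D_f = 1`. -/
theorem dw_neg_mul_dw (f : n → ℝ) : dw (-f) * dw f = 1 := by
  rw [dw_mul_dw, neg_add_cancel, dw_zero]

/-- [folklore] `D_f⁻¹ = D_{−f}`. -/
theorem dw_inv (f : n → ℝ) : (dw f)⁻¹ = dw (-f) := Matrix.inv_eq_right_inv (dw_mul_dw_neg f)

omit [Fintype n] in
/-- [folklore] `D_f` is Hermitian (real diagonal). -/
theorem conjTranspose_dw (f : n → ℝ) : (dw f)ᴴ = dw f := by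
  unfold dw
  rw [Matrix.diagonal_conjTranspose]
  congr 1
  funext i
  rw [Pi.star_apply, Complex.star_def, Complex.conj_ofReal]

/-- [folklore] **entries of the weighted conjugation**: `(D_f M D_{−f}) i j = e^{f i − f j} · M i j`. -/
theorem wConj_apply (f : n → ℝ) (M : Matrix n n ℂ) (i j : n) :
    wConj f M i j = ((Real.exp (f i - f j) : ℝ) : ℂ) * M i j := by
  unfold wConj dw
  rw [Matrix.mul_diagonal, Matrix.diagonal_mul, Pi.neg_apply, sub_eq_add_neg, Real.exp_add, Complex.ofReal_mul]
  ring

/-- [folklore] `wConj 0 M = M`. -/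
theorem wConj_zero (M : Matrix n n ℂ) : wConj (0 : n → ℝ) M = M := by
  unfold wConj
  rw [neg_zero, dw_zero, Matrix.one_mul, Matrix.mul_one]

/-- [folklore] `wConj (−f)` undoes `wConj f`. -/
theorem wConj_neg_wConj (f : n → ℝ) (M : Matrix n n ℂ) : wConj (-f) (wConj f M) = M := by
  unfold wConj
  rw [neg_neg, ← Matrix.mul_assoc, ← Matrix.mul_assoc, dw_neg_mul_dw, Matrix.one_mul, Matrix.mul_assoc, dw_neg_mul_dw,
    Matrix.mul_one]

/-- [folklore] the adjoint flips the weight: `(D_f M D_{−f})ᴴ = D_{−f} Mᴴ D_f = wConj (−f) Mᴴ`. -/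
theorem conjTranspose_wConj (f : n → ℝ) (M : Matrix n n ℂ) : (wConj f M)ᴴ = wConj (-f) Mᴴ := by
  unfold wConj
  rw [Matrix.conjTranspose_mul, Matrix.conjTranspose_mul, conjTranspose_dw, conjTranspose_dw, neg_neg, Matrix.mul_assoc]

/-- [folklore] the inverse commutes with the weighted conjugation: `(D_f M D_{−f})⁻¹ = D_f M⁻¹ D_{−f}`. -/
theorem wConj_inv (f : n → ℝ) (M : Matrix n n ℂ) : (wConj f M)⁻¹ = wConj f M⁻¹ := by
  unfold wConj
  rw [Matrix.mul_inv_rev, Matrix.mul_inv_rev, dw_inv, dw_inv, neg_neg, Matrix.mul_assoc]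

/-- [folklore] **(d) THE SIMILARITY**: `M⁻¹ = D_{−f} · (D_f M D_{−f})⁻¹ · D_f`, i.e. `M⁻¹ = wConj (−f) ((wConj f M)⁻¹)` — decay of `M⁻¹` is boundedness of
the inverse of the WEIGHTED matrix (applied by L10 to `M = F(q + iηa)`). -/
theorem inv_eq_wConj_neg_inv_wConj (f : n → ℝ) (M : Matrix n n ℂ) : M⁻¹ = wConj (-f) (wConj f M)⁻¹ := by
  rw [wConj_inv, wConj_neg_wConj]

variable (S : Finset (Fin (d + 1) → ℤ)) (L : (Fin (d + 1) → ℤ) → Matrix n n ℂ)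

/-- [folklore] **ENTRIES OF THE WEIGHTED SHIFTED SYMBOL**: `(D_f F(p+iηa) D_{−f}) i j = Σ_{b∈S} e^{f i − f j − η a·b} · cphase b p · L b i j`. -/
theorem wConj_trigPolySymbol_imShift_apply (f : n → ℝ) (p : Fin (d + 1) → ℂ) (η : ℝ) (a : Fin (d + 1) → ℝ) (i j : n) :
    wConj f (trigPolySymbol S L (imShift p η a)) i j =
      ∑ b ∈ S, ((Real.exp (f i - f j - η * rdot a b) : ℝ) : ℂ) * cphase b p * L b i j := by
  rw [wConj_apply, trigPolySymbol_apply, Finset.mul_sum]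
  refine Finset.sum_congr rfl fun b _ => ?_
  rw [cphase_imShift, cw, sub_eq_add_neg (f i - f j), Real.exp_add, Complex.ofReal_mul]
  ring

/-- [folklore] the adjoint of the weighted shifted symbol flips BOTH the weight and the shift: `(D_f F(q+iηa) D_{−f})ᴴ = D_{−f} F(q−iηa) D_f`
under (hS) (hL) (PART 1 `conjTranspose_trigPolySymbol_imShift`). -/
theorem conjTranspose_wConj_trigPolySymbol_imShift {S L} (hS : ∀ b ∈ S, -b ∈ S) (hL : ∀ b ∈ S, L (-b) = (L b)ᴴ) (f : n → ℝ)
    (q : Fin (d + 1) → ℝ) (η : ℝ) (a : Fin (d + 1) → ℝ) :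
    (wConj f (trigPolySymbol S L (imShift (ofRealVec q) η a)))ᴴ = wConj (-f) (trigPolySymbol S L (imShift (ofRealVec q) (-η) a)) := by
  rw [conjTranspose_wConj, conjTranspose_trigPolySymbol_imShift hS hL]

/-! ## §6 The weighted form as a triple sum and THE COSH IDENTITY -/

omit [DecidableEq n] in
/-- [folklore] the form as a double sum: `⟨x, M x⟩ = Σ_i Σ_j conj(x i) · M i j · x j`. -/
theorem form_eq_sum (M : Matrix n n ℂ) (x : n → ℂ) : star x ⬝ᵥ (M *ᵥ x) = ∑ i, ∑ j, conj (x i) * M i j * x j := by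
  simp only [dotProduct, Matrix.mulVec, Pi.star_apply, Complex.star_def, Finset.mul_sum]
  exact Finset.sum_congr rfl fun i _ => Finset.sum_congr rfl fun j _ => by ring

/-- [folklore] **THE WEIGHTED SHIFTED FORM AS A TRIPLE SUM**:
`⟨x, D_f F(p+iηa) D_{−f} x⟩ = Σ_{b∈S} Σ_i Σ_j e^{f i − f j − η a·b} · (cphase b p · L b i j · conj(x i) · x j)`. -/
theorem form_wConj_imShift (f : n → ℝ) (p : Fin (d + 1) → ℂ) (η : ℝ) (a : Fin (d + 1) → ℝ) (x : n → ℂ) :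
    star x ⬝ᵥ (wConj f (trigPolySymbol S L (imShift p η a)) *ᵥ x) =
      ∑ b ∈ S, ∑ i, ∑ j, ((Real.exp (f i - f j - η * rdot a b) : ℝ) : ℂ) * (cphase b p * L b i j * (conj (x i) * x j)) := by
  have h : ∀ i j, conj (x i) * wConj f (trigPolySymbol S L (imShift p η a)) i j * x j =
      ∑ b ∈ S, ((Real.exp (f i - f j - η * rdot a b) : ℝ) : ℂ) * (cphase b p * L b i j * (conj (x i) * x j)) := by
    intro i j
    rw [wConj_trigPolySymbol_imShift_apply, Finset.mul_sum, Finset.sum_mul]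
    exact Finset.sum_congr rfl fun b _ => by ring
  rw [form_eq_sum]
  calc ∑ i, ∑ j, conj (x i) * wConj f (trigPolySymbol S L (imShift p η a)) i j * x j
      = ∑ i, ∑ j, ∑ b ∈ S, ((Real.exp (f i - f j - η * rdot a b) : ℝ) : ℂ) * (cphase b p * L b i j * (conj (x i) * x j)) :=
        Finset.sum_congr rfl fun i _ => Finset.sum_congr rfl fun j _ => h i j
    _ = ∑ i, ∑ b ∈ S, ∑ j, ((Real.exp (f i - f j - η * rdot a b) : ℝ) : ℂ) * (cphase b p * L b i j * (conj (x i) * x j)) :=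
        Finset.sum_congr rfl fun i _ => Finset.sum_comm
    _ = ∑ b ∈ S, ∑ i, ∑ j, ((Real.exp (f i - f j - η * rdot a b) : ℝ) : ℂ) * (cphase b p * L b i j * (conj (x i) * x j)) :=
        Finset.sum_comm

/-- [folklore] the unweighted, unshifted form as a triple sum: `⟨x, F(q) x⟩ = Σ_{b∈S} Σ_i Σ_j cphase b q · L b i j · conj(x i) · x j`. -/
theorem form_eq_sum₃ (p : Fin (d + 1) → ℂ) (x : n → ℂ) :
    star x ⬝ᵥ (trigPolySymbol S L p *ᵥ x) = ∑ b ∈ S, ∑ i, ∑ j, cphase b p * L b i j * (conj (x i) * x j) := by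
  have h := form_wConj_imShift S L 0 p 0 (fun _ => 0) x
  rw [wConj_zero, imShift_zero] at h
  rw [h]
  refine Finset.sum_congr rfl fun b _ => Finset.sum_congr rfl fun i _ => Finset.sum_congr rfl fun j _ => ?_
  rw [Pi.zero_apply, Pi.zero_apply, sub_self, zero_mul, sub_zero, Real.exp_zero, Complex.ofReal_one, one_mul]

omit [DecidableEq n] in
/-- [folklore] the form of one coefficient: `cphase b p · ⟨x, L b x⟩ = Σ_i Σ_j cphase b p · L b i j · conj(x i) · x j`. -/
theorem cphase_mul_form_eq_sum (b : Fin (d + 1) → ℤ) (p : Fin (d + 1) → ℂ) (x : n → ℂ) :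
    cphase b p * (star x ⬝ᵥ (L b *ᵥ x)) = ∑ i, ∑ j, cphase b p * L b i j * (conj (x i) * x j) := by
  rw [form_eq_sum, Finset.mul_sum]
  refine Finset.sum_congr rfl fun i _ => ?_
  rw [Finset.mul_sum]
  exact Finset.sum_congr rfl fun j _ => by ring

variable {S L}

omit [Fintype n] [DecidableEq n] in
/-- [folklore] THE PAIRING `(b,i,j) ↔ (−b,j,i)`: under (hL) the real parts of the paired entry terms agree at real momentum. -/
theorem re_entry_pair (hL : ∀ b ∈ S, L (-b) = (L b)ᴴ) (q : Fin (d + 1) → ℝ) (x : n → ℂ) {b : Fin (d + 1) → ℤ} (hb : b ∈ S) (i j : n) :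
    (cphase (-b) (ofRealVec q) * L (-b) j i * (conj (x j) * x i)).re = (cphase b (ofRealVec q) * L b i j * (conj (x i) * x j)).re := by
  rw [hL b hb, Matrix.conjTranspose_apply, Complex.star_def, ← conj_cphase_ofRealVec]
  have h : conj (cphase b (ofRealVec q)) * conj (L b i j) * (conj (x j) * x i) = conj (cphase b (ofRealVec q) * L b i j * (conj (x i) * x j)) := by
    rw [map_mul, map_mul, map_mul, Complex.conj_conj]; ring
  rw [h, Complex.conj_re]

/-- [folklore] **(c) THE COSH IDENTITY WITH INTRA-BLOCK WEIGHT** (fibre analogue of `King1986.UniformDecay.form_conj_eq_cosh`, typer amendment 00:03:51Z):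
under (hS) (hL), at real momentum `q`, for every real `η`, direction `a` and weight `f : n → ℝ`,
`re ⟨x, D_f F(q+iηa) D_{−f} x⟩ = Σ_{b∈S} Σ_i Σ_j cosh(f i − f j − η a·b) · re(cphase b q · L b i j · conj(x i) · x j)` — the `sinh` part is odd under
`(b,i,j) ↔ (−b,j,i)` and cancels. -/
theorem re_form_wConj_imShift_eq_cosh (hS : ∀ b ∈ S, -b ∈ S) (hL : ∀ b ∈ S, L (-b) = (L b)ᴴ) (f : n → ℝ) (q : Fin (d + 1) → ℝ)
    (η : ℝ) (a : Fin (d + 1) → ℝ) (x : n → ℂ) :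
    (star x ⬝ᵥ (wConj f (trigPolySymbol S L (imShift (ofRealVec q) η a)) *ᵥ x)).re =
      ∑ b ∈ S, ∑ i, ∑ j, Real.cosh (f i - f j - η * rdot a b) * (cphase b (ofRealVec q) * L b i j * (conj (x i) * x j)).re := by
  set r : (Fin (d + 1) → ℤ) → n → n → ℝ := fun b i j => (cphase b (ofRealVec q) * L b i j * (conj (x i) * x j)).re with hr
  have hre : (star x ⬝ᵥ (wConj f (trigPolySymbol S L (imShift (ofRealVec q) η a)) *ᵥ x)).re =
      ∑ b ∈ S, ∑ i, ∑ j, Real.exp (f i - f j - η * rdot a b) * r b i j := by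
    rw [form_wConj_imShift, Complex.re_sum]
    refine Finset.sum_congr rfl fun b _ => ?_
    rw [Complex.re_sum]
    refine Finset.sum_congr rfl fun i _ => ?_
    rw [Complex.re_sum]
    refine Finset.sum_congr rfl fun j _ => ?_
    rw [Complex.re_ofReal_mul]
  -- the reflected sum: re-index `b ↦ −b`, swap `i ↔ j`, use the pairing
  have hswap : ∑ b ∈ S, ∑ i, ∑ j, Real.exp (f i - f j - η * rdot a b) * r b i j =
      ∑ b ∈ S, ∑ i, ∑ j, Real.exp (-(f i - f j - η * rdot a b)) * r b i j := by
    rw [← sum_neg_index hS (fun b => ∑ i, ∑ j, Real.exp (f i - f j - η * rdot a b) * r b i j)]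
    refine Finset.sum_congr rfl fun b hb => ?_
    rw [Finset.sum_comm]
    refine Finset.sum_congr rfl fun i _ => Finset.sum_congr rfl fun j _ => ?_
    simp only [hr]
    rw [re_entry_pair hL q x hb i j, rdot_neg]
    congr 2
    ring
  have h2 : (∑ b ∈ S, ∑ i, ∑ j, Real.exp (f i - f j - η * rdot a b) * r b i j) +
      ∑ b ∈ S, ∑ i, ∑ j, Real.exp (-(f i - f j - η * rdot a b)) * r b i j =
      2 * ∑ b ∈ S, ∑ i, ∑ j, Real.cosh (f i - f j - η * rdot a b) * r b i j := by
    rw [← Finset.sum_add_distrib, Finset.mul_sum]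
    refine Finset.sum_congr rfl fun b _ => ?_
    rw [← Finset.sum_add_distrib, Finset.mul_sum]
    refine Finset.sum_congr rfl fun i _ => ?_
    rw [← Finset.sum_add_distrib, Finset.mul_sum]
    refine Finset.sum_congr rfl fun j _ => ?_
    rw [Real.cosh_eq]
    ring
  rw [hre]
  linarith

/-- [folklore] **(c) THE COSH IDENTITY, block-constant weight (`f = 0`)**: `re ⟨x, F(q+iηa) x⟩ = Σ_{b∈S} cosh(η a·b) · re(cphase b q · ⟨x, L b x⟩)`. -/
theorem re_form_imShift_eq_cosh (hS : ∀ b ∈ S, -b ∈ S) (hL : ∀ b ∈ S, L (-b) = (L b)ᴴ) (q : Fin (d + 1) → ℝ) (η : ℝ)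
    (a : Fin (d + 1) → ℝ) (x : n → ℂ) :
    (star x ⬝ᵥ (trigPolySymbol S L (imShift (ofRealVec q) η a) *ᵥ x)).re =
      ∑ b ∈ S, Real.cosh (η * rdot a b) * (cphase b (ofRealVec q) * (star x ⬝ᵥ (L b *ᵥ x))).re := by
  have h := re_form_wConj_imShift_eq_cosh hS hL 0 q η a x
  rw [wConj_zero] at h
  rw [h]
  refine Finset.sum_congr rfl fun b _ => ?_
  rw [cphase_mul_form_eq_sum, Complex.re_sum, Finset.mul_sum]
  refine Finset.sum_congr rfl fun i _ => ?_
  rw [Complex.re_sum, Finset.mul_sum]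
  refine Finset.sum_congr rfl fun j _ => ?_
  rw [Pi.zero_apply, Pi.zero_apply, sub_self, zero_sub, Real.cosh_neg]

/-! ## §7 The conjugation defect of the form and its bound `(cosh Θ − 1)·ρ·‖x‖²` -/

/-- [folklore] the real part of the unshifted form as a triple sum. -/
theorem re_form_eq_sum₃ (q : Fin (d + 1) → ℝ) (x : n → ℂ) :
    (star x ⬝ᵥ (trigPolySymbol S L (ofRealVec q) *ᵥ x)).re =
      ∑ b ∈ S, ∑ i, ∑ j, (cphase b (ofRealVec q) * L b i j * (conj (x i) * x j)).re := by
  rw [form_eq_sum₃, Complex.re_sum]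
  refine Finset.sum_congr rfl fun b _ => ?_
  rw [Complex.re_sum]
  exact Finset.sum_congr rfl fun i _ => Complex.re_sum _ _

/-- [folklore] **(c) THE CONJUGATION DEFECT OF THE FORM**:
`re ⟨x, D_f F(q+iηa) D_{−f} x⟩ − re ⟨x, F(q) x⟩ = Σ_{b∈S} Σ_i Σ_j (cosh(f i − f j − η a·b) − 1) · re(cphase b q · L b i j · conj(x i) · x j)`. -/
theorem re_form_wConj_imShift_sub_eq (hS : ∀ b ∈ S, -b ∈ S) (hL : ∀ b ∈ S, L (-b) = (L b)ᴴ) (f : n → ℝ) (q : Fin (d + 1) → ℝ)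
    (η : ℝ) (a : Fin (d + 1) → ℝ) (x : n → ℂ) :
    (star x ⬝ᵥ (wConj f (trigPolySymbol S L (imShift (ofRealVec q) η a)) *ᵥ x)).re -
        (star x ⬝ᵥ (trigPolySymbol S L (ofRealVec q) *ᵥ x)).re =
      ∑ b ∈ S, ∑ i, ∑ j, (Real.cosh (f i - f j - η * rdot a b) - 1) * (cphase b (ofRealVec q) * L b i j * (conj (x i) * x j)).re := by
  rw [re_form_wConj_imShift_eq_cosh hS hL, re_form_eq_sum₃, ← Finset.sum_sub_distrib]
  refine Finset.sum_congr rfl fun b _ => ?_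
  rw [← Finset.sum_sub_distrib]
  refine Finset.sum_congr rfl fun i _ => ?_
  rw [← Finset.sum_sub_distrib]
  exact Finset.sum_congr rfl fun j _ => by ring

omit [Fintype n] [DecidableEq n] in
/-- [folklore] termwise: `|(cosh w − 1)·re(cphase b q · L b i j · conj(x i) x j)| ≤ (cosh Θ − 1)·‖L b i j‖·‖x i‖·‖x j‖` whenever `|w| ≤ Θ` on the support of `L b i j`. -/
theorem abs_defect_term_le {w Θ : ℝ} (q : Fin (d + 1) → ℝ) (x : n → ℂ) (b : Fin (d + 1) → ℤ) (i j : n)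
    (hΘ : L b i j ≠ 0 → |w| ≤ Θ) :
    |(Real.cosh w - 1) * (cphase b (ofRealVec q) * L b i j * (conj (x i) * x j)).re| ≤
      (Real.cosh Θ - 1) * (‖L b i j‖ * (‖x i‖ * ‖x j‖)) := by
  by_cases h0 : L b i j = 0
  · rw [h0]; simp
  have hw : Real.cosh w - 1 ≤ Real.cosh Θ - 1 :=
    sub_le_sub_right (Real.cosh_le_cosh.mpr ((hΘ h0).trans (le_abs_self Θ))) 1
  rw [abs_mul, abs_of_nonneg (sub_nonneg.mpr (Real.one_le_cosh w))]
  refine mul_le_mul hw ?_ (abs_nonneg _) (sub_nonneg.mpr (Real.one_le_cosh Θ))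
  refine (Complex.abs_re_le_norm _).trans ?_
  rw [norm_mul, norm_mul, norm_mul, norm_cphase_ofRealVec, one_mul, Complex.norm_conj]

/-- [folklore] **(c) THE DEFECT BOUND, entry currency**: under (hS) (hL) and the SUPPORT RANGE `hΘ : L b i j ≠ 0 → |f i − f j − η a·b| ≤ Θ`,
`|re ⟨x, D_f F(q+iηa) D_{−f} x⟩ − re ⟨x, F(q) x⟩| ≤ (cosh Θ − 1) · Σ_{b∈S} Σ_i Σ_j ‖L b i j‖·‖x i‖·‖x j‖`. -/
theorem abs_re_form_wConj_sub_le (hS : ∀ b ∈ S, -b ∈ S) (hL : ∀ b ∈ S, L (-b) = (L b)ᴴ) (f : n → ℝ) (q : Fin (d + 1) → ℝ)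
    (η : ℝ) (a : Fin (d + 1) → ℝ) {Θ : ℝ} (hΘ : ∀ b ∈ S, ∀ i j, L b i j ≠ 0 → |f i - f j - η * rdot a b| ≤ Θ) (x : n → ℂ) :
    |(star x ⬝ᵥ (wConj f (trigPolySymbol S L (imShift (ofRealVec q) η a)) *ᵥ x)).re -
        (star x ⬝ᵥ (trigPolySymbol S L (ofRealVec q) *ᵥ x)).re| ≤
      (Real.cosh Θ - 1) * ∑ b ∈ S, ∑ i, ∑ j, ‖L b i j‖ * (‖x i‖ * ‖x j‖) := by
  rw [re_form_wConj_imShift_sub_eq hS hL, Finset.mul_sum]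
  refine (Finset.abs_sum_le_sum_abs _ _).trans (Finset.sum_le_sum fun b hb => ?_)
  rw [Finset.mul_sum]
  refine (Finset.abs_sum_le_sum_abs _ _).trans (Finset.sum_le_sum fun i _ => ?_)
  rw [Finset.mul_sum]
  refine (Finset.abs_sum_le_sum_abs _ _).trans (Finset.sum_le_sum fun j _ => ?_)
  exact abs_defect_term_le q x b i j (hΘ b hb i j)

omit [DecidableEq n] in
/-- [folklore] THE SCHUR TEST (real form): nonnegative kernel `K` with row and column sums `≤ ρ` ⇒ `Σ_i Σ_j K i j · y i · y j ≤ ρ · Σ_i (y i)²`. -/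
theorem schur_sum_le {K : n → n → ℝ} {ρ : ℝ} (hK : ∀ i j, 0 ≤ K i j) (hrow : ∀ i, ∑ j, K i j ≤ ρ)
    (hcol : ∀ j, ∑ i, K i j ≤ ρ) (y : n → ℝ) : ∑ i, ∑ j, K i j * (y i * y j) ≤ ρ * ∑ i, y i ^ 2 := by
  have h1 : ∑ i, ∑ j, K i j * (y i * y j) ≤ ∑ i, ∑ j, (K i j * (y i ^ 2 / 2) + K i j * (y j ^ 2 / 2)) :=
    Finset.sum_le_sum fun i _ => Finset.sum_le_sum fun j _ => by
      rw [← mul_add]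
      exact mul_le_mul_of_nonneg_left (by nlinarith [two_mul_le_add_sq (y i) (y j)]) (hK i j)
  have h2 : ∑ i, ∑ j, (K i j * (y i ^ 2 / 2) + K i j * (y j ^ 2 / 2)) =
      (∑ i, (∑ j, K i j) * (y i ^ 2 / 2)) + ∑ j, (∑ i, K i j) * (y j ^ 2 / 2) := by
    have hA : ∀ i, ∑ j, (K i j * (y i ^ 2 / 2) + K i j * (y j ^ 2 / 2)) =
        (∑ j, K i j) * (y i ^ 2 / 2) + ∑ j, K i j * (y j ^ 2 / 2) := fun i => by
      rw [Finset.sum_add_distrib, Finset.sum_mul]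
    rw [Finset.sum_congr rfl fun i _ => hA i, Finset.sum_add_distrib]
    congr 1
    rw [Finset.sum_comm]
    exact Finset.sum_congr rfl fun j _ => by rw [Finset.sum_mul]
  have h3 : ∀ i, (∑ j, K i j) * (y i ^ 2 / 2) ≤ ρ * (y i ^ 2 / 2) := fun i =>
    mul_le_mul_of_nonneg_right (hrow i) (by positivity)
  have h4 : ∀ j, (∑ i, K i j) * (y j ^ 2 / 2) ≤ ρ * (y j ^ 2 / 2) := fun j =>
    mul_le_mul_of_nonneg_right (hcol j) (by positivity)
  have h5 : (∑ i, ρ * (y i ^ 2 / 2)) = ρ * (∑ i, y i ^ 2) / 2 := by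
    rw [Finset.mul_sum, Finset.sum_div]
    exact Finset.sum_congr rfl fun i _ => by ring
  calc ∑ i, ∑ j, K i j * (y i * y j)
      ≤ (∑ i, (∑ j, K i j) * (y i ^ 2 / 2)) + ∑ j, (∑ i, K i j) * (y j ^ 2 / 2) := h1.trans (le_of_eq h2)
    _ ≤ (∑ i, ρ * (y i ^ 2 / 2)) + ∑ j, ρ * (y j ^ 2 / 2) :=
        add_le_add (Finset.sum_le_sum fun i _ => h3 i) (Finset.sum_le_sum fun j _ => h4 j)
    _ = ρ * ∑ i, y i ^ 2 := by rw [h5]; ring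

omit [DecidableEq n] in
/-- [folklore] THE SCHUR TEST for the entry majorant: if the row and column sums of `K i j := Σ_{b∈S} ‖L b i j‖` are `≤ ρ`, then
`Σ_{b∈S} Σ_i Σ_j ‖L b i j‖·‖x i‖·‖x j‖ ≤ ρ · Σ_i ‖x i‖²`. -/
theorem sum₃_le_schur {ρ : ℝ} (hrow : ∀ i, ∑ j, ∑ b ∈ S, ‖L b i j‖ ≤ ρ) (hcol : ∀ j, ∑ i, ∑ b ∈ S, ‖L b i j‖ ≤ ρ) (x : n → ℂ) :
    ∑ b ∈ S, ∑ i, ∑ j, ‖L b i j‖ * (‖x i‖ * ‖x j‖) ≤ ρ * ∑ i, ‖x i‖ ^ 2 := by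
  calc ∑ b ∈ S, ∑ i, ∑ j, ‖L b i j‖ * (‖x i‖ * ‖x j‖)
      = ∑ i, ∑ b ∈ S, ∑ j, ‖L b i j‖ * (‖x i‖ * ‖x j‖) := Finset.sum_comm
    _ = ∑ i, ∑ j, ∑ b ∈ S, ‖L b i j‖ * (‖x i‖ * ‖x j‖) := Finset.sum_congr rfl fun i _ => Finset.sum_comm
    _ = ∑ i, ∑ j, (∑ b ∈ S, ‖L b i j‖) * (‖x i‖ * ‖x j‖) :=
        Finset.sum_congr rfl fun i _ => Finset.sum_congr rfl fun j _ => by rw [Finset.sum_mul]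
    _ ≤ ρ * ∑ i, ‖x i‖ ^ 2 :=
        schur_sum_le (fun i j => Finset.sum_nonneg fun b _ => norm_nonneg _) hrow hcol (fun i => ‖x i‖)

/-- [folklore] **(c) THE DEFECT BOUND `(cosh Θ − 1)·ρ·‖x‖²`** (typer amendment: «defect ≤ (cosh Θ − 1)·ρ‖x‖², Θ = max over the support of
|f i − f j ∓ η a·b|»): under (hS) (hL), the support range `hΘ` and the Schur bounds `hrow`, `hcol`. -/
theorem abs_re_form_wConj_sub_le_schur (hS : ∀ b ∈ S, -b ∈ S) (hL : ∀ b ∈ S, L (-b) = (L b)ᴴ) (f : n → ℝ) (q : Fin (d + 1) → ℝ)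
    (η : ℝ) (a : Fin (d + 1) → ℝ) {Θ ρ : ℝ} (hΘ : ∀ b ∈ S, ∀ i j, L b i j ≠ 0 → |f i - f j - η * rdot a b| ≤ Θ)
    (hrow : ∀ i, ∑ j, ∑ b ∈ S, ‖L b i j‖ ≤ ρ) (hcol : ∀ j, ∑ i, ∑ b ∈ S, ‖L b i j‖ ≤ ρ) (x : n → ℂ) :
    |(star x ⬝ᵥ (wConj f (trigPolySymbol S L (imShift (ofRealVec q) η a)) *ᵥ x)).re -
        (star x ⬝ᵥ (trigPolySymbol S L (ofRealVec q) *ᵥ x)).re| ≤ (Real.cosh Θ - 1) * ρ * ∑ i, ‖x i‖ ^ 2 := by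
  refine (abs_re_form_wConj_sub_le hS hL f q η a hΘ x).trans ?_
  rw [mul_assoc]
  exact mul_le_mul_of_nonneg_left (sum₃_le_schur hrow hcol x) (sub_nonneg.mpr (Real.one_le_cosh Θ))

/-- [folklore] **(c) THE LOWER BOUND**: `re ⟨x, F(q) x⟩ − (cosh Θ − 1)·ρ·Σ_i ‖x i‖² ≤ re ⟨x, D_f F(q+iηa) D_{−f} x⟩` — the weighted conjugation loses a
SECOND-ORDER amount (in `Θ`) of the real part of the form. -/
theorem re_form_wConj_imShift_ge (hS : ∀ b ∈ S, -b ∈ S) (hL : ∀ b ∈ S, L (-b) = (L b)ᴴ) (f : n → ℝ) (q : Fin (d + 1) → ℝ)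
    (η : ℝ) (a : Fin (d + 1) → ℝ) {Θ ρ : ℝ} (hΘ : ∀ b ∈ S, ∀ i j, L b i j ≠ 0 → |f i - f j - η * rdot a b| ≤ Θ)
    (hrow : ∀ i, ∑ j, ∑ b ∈ S, ‖L b i j‖ ≤ ρ) (hcol : ∀ j, ∑ i, ∑ b ∈ S, ‖L b i j‖ ≤ ρ) (x : n → ℂ) :
    (star x ⬝ᵥ (trigPolySymbol S L (ofRealVec q) *ᵥ x)).re - (Real.cosh Θ - 1) * ρ * ∑ i, ‖x i‖ ^ 2 ≤
      (star x ⬝ᵥ (wConj f (trigPolySymbol S L (imShift (ofRealVec q) η a)) *ᵥ x)).re := by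
  have h := abs_re_form_wConj_sub_le_schur hS hL f q η a hΘ hrow hcol x
  rw [abs_le] at h
  linarith [h.1]

omit [Fintype n] [DecidableEq n] in
/-- [folklore] the `f = 0` support range from the displacement range: `|0 − 0 − η a·b| ≤ |η|·R` when `|a·b| ≤ R` on `S`. -/
theorem theta_zero_of_range {a : Fin (d + 1) → ℝ} {R : ℝ} (hR : ∀ b ∈ S, |rdot a b| ≤ R) (η : ℝ) :
    ∀ b ∈ S, ∀ i j : n, L b i j ≠ 0 → |(0 : n → ℝ) i - (0 : n → ℝ) j - η * rdot a b| ≤ |η| * R := by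
  intro b hb i j _
  rw [Pi.zero_apply, Pi.zero_apply, sub_self, zero_sub, abs_neg, abs_mul]
  exact mul_le_mul_of_nonneg_left (hR b hb) (abs_nonneg η)

end Summit.QuantumFields.BalabanUV.Beta.GAN24.FibreSymbolShiftCosh

end
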